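import Summits.BirchSwinnertonDyer.BirchSwinnertonDyer.Theorems.QuadraticBranchSignedControlPlusEtaNonsurjThetaFunctionalEquationNormCoordinateDivisibility
import HarnessLib

/-!
# Route `QuadraticBranchSignedControl` (rung K8, cell `bsd-potss`), residual crux `PlusEtaMainConjectureNonsurj`
# (stmt-BirchSwinnertonDyer-19606): THE FUNCTIONAL EQUATION ON THE QUADRATIC BRANCH, XXXIII — THE `η`-MAIN CONJECTURE AT A ROW IN THE
# NORM COORDINATE: **Kobayashi's `pⁿ·L ∈ Char` reads `μ_alg ≤ μ_an + n ∧ r_alg ≤ r_an ∧ H_alg ∣ H_an` in `ℤ_p[Z]`**, the Eisenstein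
# inclusion `Char ⊆ (L)` reads the reverse, **`Char = (L)` ⟺ `μ`, `r₀`, `H` agree**, and BOTH halves force `H_alg = H_an`, `P_alg = P_an`
# and leave exactly `μ_alg = μ_an` (seat `bsd-potss-k8eta-c2` g31; kernel; algebraic side CONDITIONAL on Kim 3.11η as in Parts XXII/XXVII)

WHY. g30 NEXT (2). The crux at a row is `Char X⁺(V/K_∞)^η = (L_p⁺(V, η, X))` (node `QuadraticBranchPlusEtaMainConjectureAt`, print
currency). Kobayashi's Thm. 4.1 at `η` gives `pⁿ·L_p⁺(V, η, X) ∈ Char` (named fact `thm41_plusEtaCharIdeal_dvd`; `n = 0` on the onto locus,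
structural slack off it); crux 19601 (`PlusEtaLowerInclusion`) is `Char ⊆ (L_p⁺(V, η, X))`. Parts XXVI (analytic, fact-free) and XXVII
(algebraic, granted Kim 3.11η) put both generators into the normal form `p^m · T^{r₀}(1+T)^k H(Z) · unit`, `H ∈ ℤ_p[Z]` distinguished, and
Part XXXII proved the divisibility dictionary for such forms. THIS FILE writes the three statements of the crux at a row in that currency:
* (§97) the two-sided squeeze for norm forms: `f₁ ∣ pⁿf₂` and `f₂ ∣ f₁` ⟹ `r₁ = r₂`, `H₁ = H₂`, `P₁ = P₂`, `m₂ ≤ m₁ ≤ m₂ + n`, and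
  `(f₁) = (f₂) ⟺ m₁ = m₂`;
* (§98) for an ideal `I = (g)` and an element `L`, both with norm forms: **`pⁿL ∈ I` ⟹ `m_g ≤ m_L + n ∧ r_g ≤ r_L ∧ H_g ∣ H_L`**;
  **`I ≤ (L)` ⟹ `m_L ≤ m_g ∧ r_L ≤ r_g ∧ H_L ∣ H_g`**; **`I = (L)` ⟺ `m_g = m_L ∧ r_g = r_L ∧ H_g = H_L`**; both inclusions ⟹ `H_g = H_L`,
  `P_g = P_L` and `I = (L) ⟺ m_g = m_L`; and THE RATIONAL-PAIR CONSTRAINT: if `deg H_L = 1` (`λ_an = r₀ + 2`: 19 of the 44 level-4 rows of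
  P-29R/P-30Z, including the two EXISTS rows of P-30M where `P_an = T(T − c)(T − c^ι)` SPLITS over `ℤ_5`) then `pⁿL ∈ I` forces
  **`H_g = 1 ∨ H_g = H_L`** — an `ι`-stable `Char` can never take ONE zero of the pair `{c, c^ι}`: `λ_alg − r_alg ∈ {0, 2}`;
* (§99) ON THE CRUX'S OBJECTS (plus sign): `V` good at `p ≥ 5` with `a_p(V) = 0` (every row), `f` its newform, ANY period ratio, ANY nonzero
  `Lη = L_p⁺(V, η, X)` with ANY Weierstrass datum, and — granted Kim 3.11η (hypothesis position) — ANY `η`-dual datum `D` with ANY nonzero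
  generator `g` of `Char(D.X)` and ANY Weierstrass datum of `g`: the norm polynomials `H_an`, `H_alg` EXIST (Parts XXVI/XXVII) and satisfy the
  three readings above VERBATIM with `I = D.charIdeal`; in particular **(C1⁺_η) at the datum ⟺ `μ_alg = μ_an ∧ r₀,alg = r₀,an ∧ H_alg = H_an`**,
  and the typed node `QuadraticBranchPlusEtaMainConjectureAt V p` IMPLIES the three equalities for every such datum (`ε = 1`).

MATHEMATICS. Part XXXII (`normForm_dvd_iff`, `normForm_dvd_C_pow_mul_iff`, `normForm_span_eq_iff`) plus ideal bookkeeping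
(`x ∈ (g) ⟺ g ∣ x`, `(g) ≤ (L) ⟺ L ∣ g`, `(p : Λ)ⁿ = C(pⁿ)`); a monic divisor of a monic polynomial of degree `1` is `1` or the polynomial.

WHAT (14 theorems). §97 **`normForm_dvd_antisymm`**; §98 `natCast_pow_eq_C_pow`, `natCast_pow_mul_mem_span_singleton_iff`, **`normForm_of_pow_mul_mem_span`**
(Kato reading), **`normForm_of_span_le_span`** (Eisenstein reading), **`span_eq_span_iff_normForm`** (main conjecture reading), **`normForm_squeeze`**,
`eq_one_or_eq_of_dvd_of_natDegree_eq_one`, **`normPoly_eq_one_or_eq_of_pow_mul_mem_span`** (rational-pair constraint); §99 `exists_normForm_plus_row`,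
**`exists_normForm_pair_plus_of_kim`** (both norm forms + the three readings at a row; CONDITIONAL on Kim 3.11η),
**`normForm_eq_of_plusEtaMainConjectureAt_of_kim`** ((C1⁺_η) ⟹ the three equalities), `normForm_of_thm41_of_kim` (Thm. 4.1η ⟹ the Kato reading, both
named facts in hypothesis position), `normForm_of_plusEtaLowerInclusionAt_of_kim` ((E⁺_η) ⟹ the Eisenstein reading).

HONEST FRAMING (cell `bsd-potss`; FULL-BSD rank ≤ 1 programme, HUMAN RULING D-0036/D-0074): TOOL THEOREMS ONLY — no definition, no `sorry`,
axioms standard; §97–§98 and `exists_normForm_plus_row` use NO named fact; the `_of_kim` theorems take `Kim2008.thm311_etaSignedSelmerDual_charIdeal_map_invol`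
(and, where displayed, `Kobayashi2003.thm41_plusEtaCharIdeal_dvd` / the typed conjectures (C1⁺_η), (E⁺_η)) in HYPOTHESIS position — conditional
readings, nothing discharged or asserted; nothing about (A), (C1⁺_η), C-cc-1 or `BSD(W,p)` of any pair is claimed; no stub of 19606 is proved;
crux and route OPEN; nothing booked. `--supports stmt-BirchSwinnertonDyer-19606`.

References: [Kobayashi2003] §4 Even main conjecture, Thm. 4.1 (p. 8); [KimBD2008MRL] Thm. 3.11 (p. 93); [GreenbergVatsal2000] p. 4 (after Thm. (1.2));
[Washington1997] §7.1 (Thm. 7.3), §13.2; [PollackRubin2004] p. 448 (CM case, remark). Tree: Parts XXVI, XXVII, XXXII; node file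
`Rank1Residual/Additive/QuadraticBranchPlusEtaNodes.lean`; `Kobayashi2003/PlusEtaCharIdealDivisibility.lean`.
-/

set_option autoImplicit false
set_option linter.dupNamespace false
noncomputable section

open scoped Classical MatrixGroups ModularForm Topology

open PowerSeries CongruenceSubgroup WeierstrassCurve Field Literature.NumberTheory.EllipticCurves
  Literature.NumberTheory.EllipticCurves.ModularForms Literature.NumberTheory.GaloisRepresentations ZpExtension
open Literature.NumberTheory.EllipticCurves.IwasawaAlgebra
open Summit.BirchSwinnertonDyer.Rank1Residual.Additive

namespace Summit.BirchSwinnertonDyer.BirchSwinnertonDyer.Theorems.EtaThetaFunctionalEquation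

variable {p : ℕ} [hp : Fact p.Prime] {r : ℤ_[p]} {S Z : IwasawaAlgebra p}

/-! ## §97 The two-sided squeeze for norm forms -/

/-- **Two-sided squeeze in the norm coordinate**: `f₁ ∣ pⁿ·f₂` (Kato-type, with slack `n`) and `f₂ ∣ f₁` (Eisenstein-type) force
**`r₁ = r₂`, `H₁ = H₂`, `P₁ = P₂`** — the Weierstrass polynomials agree outright and only `m₂ ≤ m₁ ≤ m₂ + n` remains: `(f₁) = (f₂) ⟺ m₁ = m₂`.
[cite: Washington1997, §7.1 (Thm. 7.3)] [cite: GreenbergVatsal2000, p. 4 (after Thm. (1.2))] [cite: Kobayashi2003, Thm. 4.1 (p. 8)] -/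
theorem normForm_dvd_antisymm (hr : 2 * r = -1) (hS : S = X * binomialSeries ℤ_[p] r) (hZ : Z = X + invol p X)
    {f₁ f₂ : IwasawaAlgebra p} {m₁ m₂ : ℕ} {P₁ P₂ : Polynomial ℤ_[p]}
    (hP₁ : P₁.IsDistinguishedAt (IsLocalRing.maximalIdeal ℤ_[p])) (hP₂ : P₂.IsDistinguishedAt (IsLocalRing.maximalIdeal ℤ_[p]))
    {U₁ U₂ : IwasawaAlgebra p} (hU₁ : IsUnit U₁) (hU₂ : IsUnit U₂)
    (hf₁ : f₁ = C ((p : ℤ_[p]) ^ m₁) * (P₁ : IwasawaAlgebra p) * U₁) (hf₂ : f₂ = C ((p : ℤ_[p]) ^ m₂) * (P₂ : IwasawaAlgebra p) * U₂)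
    {H₁ H₂ : Polynomial ℤ_[p]} (hH₁ : H₁.IsDistinguishedAt (IsLocalRing.maximalIdeal ℤ_[p]))
    (hH₂ : H₂.IsDistinguishedAt (IsLocalRing.maximalIdeal ℤ_[p]))
    (hPH₁ : (P₁ : IwasawaAlgebra p) = X ^ (PowerSeries.order f₁).toNat * (1 + X) ^ H₁.natDegree * PowerSeries.subst Z (H₁ : IwasawaAlgebra p))
    (hPH₂ : (P₂ : IwasawaAlgebra p) = X ^ (PowerSeries.order f₂).toNat * (1 + X) ^ H₂.natDegree * PowerSeries.subst Z (H₂ : IwasawaAlgebra p))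
    {n : ℕ} (hKato : f₁ ∣ C ((p : ℤ_[p]) ^ n) * f₂) (hEis : f₂ ∣ f₁) :
    (PowerSeries.order f₁).toNat = (PowerSeries.order f₂).toNat ∧ H₁ = H₂ ∧ P₁ = P₂ ∧ m₂ ≤ m₁ ∧ m₁ ≤ m₂ + n ∧
      (Ideal.span {f₁} = Ideal.span {f₂} ↔ m₁ = m₂) := by
  obtain ⟨hm12, hr12, hH12⟩ := (normForm_dvd_C_pow_mul_iff hr hS hZ hP₁ hP₂ hU₁ hU₂ hf₁ hf₂ hH₁ hH₂ hPH₁ hPH₂ n).mp hKato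
  obtain ⟨hm21, hr21, hH21⟩ := (normForm_dvd_iff hr hS hZ hP₂ hP₁ hU₂ hU₁ hf₂ hf₁ hH₂ hH₁ hPH₂ hPH₁).mp hEis
  have hrr : (PowerSeries.order f₁).toNat = (PowerSeries.order f₂).toNat := le_antisymm hr12 hr21
  have hHH : H₁ = H₂ := Polynomial.eq_of_monic_of_associated hH₁.monic hH₂.monic (associated_of_dvd_dvd hH12 hH21)
  have hPP : P₁ = P₂ := by
    apply Polynomial.coe_injective
    rw [hPH₁, hPH₂, hrr, hHH]
  refine ⟨hrr, hHH, hPP, hm21, hm12, ?_⟩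
  rw [normForm_span_eq_iff hr hS hZ hP₁ hP₂ hU₁ hU₂ hf₁ hf₂ hH₁ hH₂ hPH₁ hPH₂]
  exact ⟨fun h ↦ h.1, fun h ↦ ⟨h, hrr, hHH⟩⟩

/-! ## §98 An ideal `I = (g)` against an element `L`, both with norm forms: the Kato, Eisenstein and main-conjecture readings -/

/-- `(p : Λ)ⁿ = C(pⁿ)`. [folklore] -/
theorem natCast_pow_eq_C_pow (n : ℕ) : ((p : IwasawaAlgebra p) ^ n : IwasawaAlgebra p) = C ((p : ℤ_[p]) ^ n) := by
  rw [map_pow, map_natCast]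

/-- `pⁿ·L ∈ (g) ⟺ g ∣ C(pⁿ)·L`. [folklore] -/
theorem natCast_pow_mul_mem_span_singleton_iff (n : ℕ) (L g : IwasawaAlgebra p) :
    (p : IwasawaAlgebra p) ^ n * L ∈ Ideal.span {g} ↔ g ∣ C ((p : ℤ_[p]) ^ n) * L := by
  rw [Ideal.mem_span_singleton, natCast_pow_eq_C_pow]

section Readings

variable {g L : IwasawaAlgebra p} {mg mL : ℕ} {Pg PL Hg HL : Polynomial ℤ_[p]} {Ug UL : IwasawaAlgebra p} {I : Ideal (IwasawaAlgebra p)}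

/-- **THE KATO READING: `pⁿ·L ∈ (g)` ⟹ `m_g ≤ m_L + n ∧ r_g ≤ r_L ∧ H_g ∣ H_L` in `ℤ_p[Z]`** — for `I = (g)` and `L` with Weierstrass data
`g = p^{m_g}P_gU_g`, `L = p^{m_L}P_LU_L` and norm forms `P = T^{ord}(1+T)^kH(Z)` (`p` odd). The shape of Kobayashi's Thm. 4.1 at `η`
(`pⁿ·L_p⁺(V,η,X) ∈ Char`): the algebraic norm polynomial DIVIDES the analytic one in the half-degree ring. [cite: Kobayashi2003, Thm. 4.1 (p. 8)]
[cite: Washington1997, §7.1 (Thm. 7.3), §13.2] [cite: GreenbergVatsal2000, p. 4] -/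
theorem normForm_of_pow_mul_mem_span (hr : 2 * r = -1) (hS : S = X * binomialSeries ℤ_[p] r) (hZ : Z = X + invol p X)
    (hPg : Pg.IsDistinguishedAt (IsLocalRing.maximalIdeal ℤ_[p])) (hPL : PL.IsDistinguishedAt (IsLocalRing.maximalIdeal ℤ_[p]))
    (hUg : IsUnit Ug) (hUL : IsUnit UL)
    (hgW : g = C ((p : ℤ_[p]) ^ mg) * (Pg : IwasawaAlgebra p) * Ug) (hLW : L = C ((p : ℤ_[p]) ^ mL) * (PL : IwasawaAlgebra p) * UL)
    (hHg : Hg.IsDistinguishedAt (IsLocalRing.maximalIdeal ℤ_[p])) (hHL : HL.IsDistinguishedAt (IsLocalRing.maximalIdeal ℤ_[p]))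
    (hPHg : (Pg : IwasawaAlgebra p) = X ^ (PowerSeries.order g).toNat * (1 + X) ^ Hg.natDegree * PowerSeries.subst Z (Hg : IwasawaAlgebra p))
    (hPHL : (PL : IwasawaAlgebra p) = X ^ (PowerSeries.order L).toNat * (1 + X) ^ HL.natDegree * PowerSeries.subst Z (HL : IwasawaAlgebra p))
    (hI : I = Ideal.span {g}) {n : ℕ} (hKato : (p : IwasawaAlgebra p) ^ n * L ∈ I) :
    mg ≤ mL + n ∧ (PowerSeries.order g).toNat ≤ (PowerSeries.order L).toNat ∧ Hg ∣ HL := by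
  rw [hI, natCast_pow_mul_mem_span_singleton_iff] at hKato
  exact (normForm_dvd_C_pow_mul_iff hr hS hZ hPg hPL hUg hUL hgW hLW hHg hHL hPHg hPHL n).mp hKato

/-- **THE EISENSTEIN READING: `(g) ⊆ (L)` ⟹ `m_L ≤ m_g ∧ r_L ≤ r_g ∧ H_L ∣ H_g` in `ℤ_p[Z]`** (same data) — the shape of the lower inclusion
`Char ⊆ (L_p⁺(V,η,X))` (crux 19601 / (E⁺_η)). [cite: Kobayashi2003, §4 Even main conjecture (p. 8)] [cite: Washington1997, §7.1 (Thm. 7.3), §13.2] -/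
theorem normForm_of_span_le_span (hr : 2 * r = -1) (hS : S = X * binomialSeries ℤ_[p] r) (hZ : Z = X + invol p X)
    (hPg : Pg.IsDistinguishedAt (IsLocalRing.maximalIdeal ℤ_[p])) (hPL : PL.IsDistinguishedAt (IsLocalRing.maximalIdeal ℤ_[p]))
    (hUg : IsUnit Ug) (hUL : IsUnit UL)
    (hgW : g = C ((p : ℤ_[p]) ^ mg) * (Pg : IwasawaAlgebra p) * Ug) (hLW : L = C ((p : ℤ_[p]) ^ mL) * (PL : IwasawaAlgebra p) * UL)
    (hHg : Hg.IsDistinguishedAt (IsLocalRing.maximalIdeal ℤ_[p])) (hHL : HL.IsDistinguishedAt (IsLocalRing.maximalIdeal ℤ_[p]))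
    (hPHg : (Pg : IwasawaAlgebra p) = X ^ (PowerSeries.order g).toNat * (1 + X) ^ Hg.natDegree * PowerSeries.subst Z (Hg : IwasawaAlgebra p))
    (hPHL : (PL : IwasawaAlgebra p) = X ^ (PowerSeries.order L).toNat * (1 + X) ^ HL.natDegree * PowerSeries.subst Z (HL : IwasawaAlgebra p))
    (hI : I = Ideal.span {g}) (hEis : I ≤ Ideal.span {L}) :
    mL ≤ mg ∧ (PowerSeries.order L).toNat ≤ (PowerSeries.order g).toNat ∧ HL ∣ Hg := by
  rw [hI, Ideal.span_singleton_le_span_singleton] at hEis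
  exact (normForm_dvd_iff hr hS hZ hPL hPg hUL hUg hLW hgW hHL hHg hPHL hPHg).mp hEis

/-- **THE MAIN-CONJECTURE READING: `(g) = (L)` ⟺ `m_g = m_L ∧ r_g = r_L ∧ H_g = H_L`** (same data): the main conjecture at a row as three
equalities of invariants — `μ`, the order at `T = 0`, and the norm polynomial in `ℤ_p[Z]`. [cite: Kobayashi2003, §4 Even main conjecture (p. 8)]
[cite: GreenbergVatsal2000, p. 4 (after Thm. (1.2))] [cite: Washington1997, §7.1 (Thm. 7.3), §13.2] -/
theorem span_eq_span_iff_normForm (hr : 2 * r = -1) (hS : S = X * binomialSeries ℤ_[p] r) (hZ : Z = X + invol p X)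
    (hPg : Pg.IsDistinguishedAt (IsLocalRing.maximalIdeal ℤ_[p])) (hPL : PL.IsDistinguishedAt (IsLocalRing.maximalIdeal ℤ_[p]))
    (hUg : IsUnit Ug) (hUL : IsUnit UL)
    (hgW : g = C ((p : ℤ_[p]) ^ mg) * (Pg : IwasawaAlgebra p) * Ug) (hLW : L = C ((p : ℤ_[p]) ^ mL) * (PL : IwasawaAlgebra p) * UL)
    (hHg : Hg.IsDistinguishedAt (IsLocalRing.maximalIdeal ℤ_[p])) (hHL : HL.IsDistinguishedAt (IsLocalRing.maximalIdeal ℤ_[p]))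
    (hPHg : (Pg : IwasawaAlgebra p) = X ^ (PowerSeries.order g).toNat * (1 + X) ^ Hg.natDegree * PowerSeries.subst Z (Hg : IwasawaAlgebra p))
    (hPHL : (PL : IwasawaAlgebra p) = X ^ (PowerSeries.order L).toNat * (1 + X) ^ HL.natDegree * PowerSeries.subst Z (HL : IwasawaAlgebra p))
    (hI : I = Ideal.span {g}) :
    I = Ideal.span {L} ↔ mg = mL ∧ (PowerSeries.order g).toNat = (PowerSeries.order L).toNat ∧ Hg = HL := by
  rw [hI]
  exact normForm_span_eq_iff hr hS hZ hPg hPL hUg hUL hgW hLW hHg hHL hPHg hPHL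

/-- **THE SQUEEZE: `pⁿL ∈ (g)` and `(g) ⊆ (L)` ⟹ `r_g = r_L`, `H_g = H_L`, `P_g = P_L`, `m_L ≤ m_g ≤ m_L + n`, and `(g) = (L) ⟺ m_g = m_L`** — with
both halves in hand the Weierstrass polynomials agree and the main conjecture at the row is the single equation `μ_alg = μ_an`.
[cite: Kobayashi2003, §4 Even main conjecture, Thm. 4.1 (p. 8)] [cite: GreenbergVatsal2000, p. 4 (after Thm. (1.2))] -/
theorem normForm_squeeze (hr : 2 * r = -1) (hS : S = X * binomialSeries ℤ_[p] r) (hZ : Z = X + invol p X)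
    (hPg : Pg.IsDistinguishedAt (IsLocalRing.maximalIdeal ℤ_[p])) (hPL : PL.IsDistinguishedAt (IsLocalRing.maximalIdeal ℤ_[p]))
    (hUg : IsUnit Ug) (hUL : IsUnit UL)
    (hgW : g = C ((p : ℤ_[p]) ^ mg) * (Pg : IwasawaAlgebra p) * Ug) (hLW : L = C ((p : ℤ_[p]) ^ mL) * (PL : IwasawaAlgebra p) * UL)
    (hHg : Hg.IsDistinguishedAt (IsLocalRing.maximalIdeal ℤ_[p])) (hHL : HL.IsDistinguishedAt (IsLocalRing.maximalIdeal ℤ_[p]))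
    (hPHg : (Pg : IwasawaAlgebra p) = X ^ (PowerSeries.order g).toNat * (1 + X) ^ Hg.natDegree * PowerSeries.subst Z (Hg : IwasawaAlgebra p))
    (hPHL : (PL : IwasawaAlgebra p) = X ^ (PowerSeries.order L).toNat * (1 + X) ^ HL.natDegree * PowerSeries.subst Z (HL : IwasawaAlgebra p))
    (hI : I = Ideal.span {g}) {n : ℕ} (hKato : (p : IwasawaAlgebra p) ^ n * L ∈ I) (hEis : I ≤ Ideal.span {L}) :
    (PowerSeries.order g).toNat = (PowerSeries.order L).toNat ∧ Hg = HL ∧ Pg = PL ∧ mL ≤ mg ∧ mg ≤ mL + n ∧ (I = Ideal.span {L} ↔ mg = mL) := by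
  rw [hI, natCast_pow_mul_mem_span_singleton_iff] at hKato
  rw [hI, Ideal.span_singleton_le_span_singleton] at hEis
  rw [hI]
  exact normForm_dvd_antisymm hr hS hZ hPg hPL hUg hUL hgW hLW hHg hHL hPHg hPHL hKato hEis

/-- A monic divisor of a monic polynomial of degree `1` is `1` or the polynomial itself. [folklore] -/
theorem eq_one_or_eq_of_dvd_of_natDegree_eq_one {A B : Polynomial ℤ_[p]} (hA : A.Monic) (hB : B.Monic) (hB1 : B.natDegree = 1) (h : A ∣ B) :
    A = 1 ∨ A = B := by
  have hdeg : A.natDegree ≤ 1 := hB1 ▸ Polynomial.natDegree_le_of_dvd h hB.ne_zero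
  rcases Nat.le_one_iff_eq_zero_or_eq_one.mp hdeg with h0 | h1
  · exact Or.inl (Polynomial.eq_one_of_monic_natDegree_zero hA h0)
  · exact Or.inr (Polynomial.eq_of_monic_of_dvd_of_natDegree_le hA hB h (by rw [h1, hB1])).symm

/-- **THE RATIONAL-PAIR CONSTRAINT: at `deg H_L = 1` (`λ(L) = ord_T L + 2`), `pⁿL ∈ (g)` forces `H_g = 1 ∨ H_g = H_L`** — an ideal `(g)` with
a norm form (every `ι`-stable principal ideal, Part XXVII; `Char X^ε(V/K_∞)^η` granted Kim 3.11η) dividing `pⁿL` takes BOTH zeros of the pair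
`{c, c^ι}` of `L` or NEITHER, even when the pair is `ℤ_p`-rational and `P_L = T^{r}(T − c)(T − c^ι)` splits (P-30M's EXISTS rows 243675z1,
388800pb1 at `p = 5`): `λ(g) − ord_T g ∈ {0, 2}`. [cite: Kobayashi2003, Thm. 4.1 (p. 8)] [cite: MazurTateTeitelbaum1986Invent, §I.17]
[cite: Washington1997, §7.1 (Thm. 7.3), §13.2] -/
theorem normPoly_eq_one_or_eq_of_pow_mul_mem_span (hr : 2 * r = -1) (hS : S = X * binomialSeries ℤ_[p] r) (hZ : Z = X + invol p X)
    (hPg : Pg.IsDistinguishedAt (IsLocalRing.maximalIdeal ℤ_[p])) (hPL : PL.IsDistinguishedAt (IsLocalRing.maximalIdeal ℤ_[p]))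
    (hUg : IsUnit Ug) (hUL : IsUnit UL)
    (hgW : g = C ((p : ℤ_[p]) ^ mg) * (Pg : IwasawaAlgebra p) * Ug) (hLW : L = C ((p : ℤ_[p]) ^ mL) * (PL : IwasawaAlgebra p) * UL)
    (hHg : Hg.IsDistinguishedAt (IsLocalRing.maximalIdeal ℤ_[p])) (hHL : HL.IsDistinguishedAt (IsLocalRing.maximalIdeal ℤ_[p]))
    (hPHg : (Pg : IwasawaAlgebra p) = X ^ (PowerSeries.order g).toNat * (1 + X) ^ Hg.natDegree * PowerSeries.subst Z (Hg : IwasawaAlgebra p))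
    (hPHL : (PL : IwasawaAlgebra p) = X ^ (PowerSeries.order L).toNat * (1 + X) ^ HL.natDegree * PowerSeries.subst Z (HL : IwasawaAlgebra p))
    (hI : I = Ideal.span {g}) {n : ℕ} (hKato : (p : IwasawaAlgebra p) ^ n * L ∈ I) (hk : HL.natDegree = 1) :
    (Hg = 1 ∨ Hg = HL) ∧ (Pg.natDegree = (PowerSeries.order g).toNat ∨ Pg.natDegree = (PowerSeries.order g).toNat + 2) := by
  obtain ⟨-, -, hdvd⟩ := normForm_of_pow_mul_mem_span hr hS hZ hPg hPL hUg hUL hgW hLW hHg hHL hPHg hPHL hI hKato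
  have hcases := eq_one_or_eq_of_dvd_of_natDegree_eq_one hHg.monic hHL.monic hk hdvd
  have hPgpoly := normForm_polynomial_eq hZ hPHg
  have hdegPg : Pg.natDegree = (PowerSeries.order g).toNat + 2 * Hg.natDegree := by
    obtain ⟨hQdeg, hQdist⟩ := normPoly_isDistinguishedAt hHg
    rw [hPgpoly, (Polynomial.monic_X_pow _).natDegree_mul hQdist.monic, Polynomial.natDegree_X_pow, hQdeg]
  refine ⟨hcases, ?_⟩
  rcases hcases with h1 | h2
  · left; rw [hdegPg, h1, Polynomial.natDegree_one, mul_zero, add_zero]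
  · right; rw [hdegPg, h2, hk, mul_one]

end Readings

/-! ## §99 On the crux's objects (plus sign): `Lη = L_p⁺(V, η, X)` against `Char X⁺(V/K_∞)^η` (algebraic side granted Kim 3.11η) -/

section Crux

variable {N : ℕ} [NeZero N] {f : CuspForm (Gamma0 N) 2}

/-- **THE NORM FORM OF `L_p⁺(V, η, X)` AT A ROW** (fact-free): `V` globally minimal, good at `p ≥ 5`, `a_p(V) = 0`, `f` its newform, `p` odd via
`2r = −1`; every nonzero `Lη` (any period ratio) with any Weierstrass datum `Lη = p^m·P·U` has `P = T^{ord Lη}(1+T)^k H_an(Z)`, `H_an ∈ ℤ_p[Z]`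
distinguished of degree `k`, `deg P = ord Lη + 2k` (Part XXVI §78 with the row's `IsNewform0` / `¬ p ∣ N` / `a_p(f) = 0` discharged).
[cite: Washington1997, §7.1 (Thm. 7.3), §13.2] [cite: MazurTateTeitelbaum1986Invent, §I.17] [cite: Kobayashi2003, Thm. 3.2, (3.4)] -/
theorem exists_normForm_plus_row (hp5 : 5 ≤ p) (V : WeierstrassCurve ℚ) [V.IsElliptic] [V.IsGloballyMinimal]
    (hgood : V.HasGoodReductionAtPrime p) (hap : V.frobeniusTrace p = 0) (hf : IsNewformOf V f)
    (hr : 2 * r = -1) (hS : S = X * binomialSeries ℤ_[p] r) (hZ : Z = X + invol p X)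
    {ϖ : ℚ} {Lη : IwasawaAlgebra p} (hL : IsQuadraticBranchPlusLFunction f p ϖ Lη) (hL0 : Lη ≠ 0)
    {m : ℕ} {P : Polynomial ℤ_[p]} (hP : P.IsDistinguishedAt (IsLocalRing.maximalIdeal ℤ_[p])) {U : IwasawaAlgebra p} (hU : IsUnit U)
    (hLP : Lη = C ((p : ℤ_[p]) ^ m) * (P : IwasawaAlgebra p) * U) :
    ∃ H : Polynomial ℤ_[p], H.IsDistinguishedAt (IsLocalRing.maximalIdeal ℤ_[p]) ∧
      (P : IwasawaAlgebra p) = X ^ (PowerSeries.order Lη).toNat * (1 + X) ^ H.natDegree * PowerSeries.subst Z (H : IwasawaAlgebra p) ∧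
      P.natDegree = (PowerSeries.order Lη).toNat + 2 * H.natDegree := by
  have hp2 : p ≠ 2 := by omega
  have hap' : cuspCoeff f p = ((0 : ℤ) : ℂ) := by
    rw [cuspCoeff_eq_frobeniusTrace_of_isNewformOf_holds hf hgood, hap]
  exact weierstrass_eq_X_pow_mul_normPoly_of_isQuadraticBranchPlusLFunction hp2 hf.1 hf.coeffField_eq_bot
    (not_dvd_level_of_isNewformOf hf hgood) hap' hr hS hZ hL hL0 hP hU hLP

variable (K₀ : Type) [Field K₀] [NumberField K₀] [IsCyclotomicExtension {p} ℚ K₀] [(galRange (K := ℚ) K₀).Normal]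
  {ηq : absoluteGaloisGroup ℚ →* ℤˣ} {V : WeierstrassCurve ℚ} [V.IsElliptic] [V.IsGloballyMinimal]
  {κ : ZpExtension ℚ p} {γ : absoluteGaloisGroup ℚ} {ε : ℤˣ}

/-- **THE `η`-MAIN CONJECTURE AT A ROW IN THE NORM COORDINATE (plus sign; algebraic side granted Kim 3.11η).** Frame: `V` globally minimal,
good at `p ≥ 5`, `a_p(V) = 0` (every row of the crux), `f` its newform, `η` trivial on `Gal(ℚ̄/ℚ(μ_p))`, `κ` cyclotomic with generator
`γ ∈ Gal(ℚ̄/K₀)`, ANY dual datum `D` of `Sel^ε(V/K_∞)^η`, ANY nonzero generator `g` of `Char(D.X)` with ANY Weierstrass datum `g = p^{m_g}P_gU_g`,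
ANY period ratio and ANY nonzero `Lη = L_p⁺(V, η, X)` with ANY Weierstrass datum `Lη = p^{m_L}P_LU_L`; `2r = −1`, `S = T(1+T)^r`, `Z = T + ιT`.
THEN there are DISTINGUISHED `H_alg, H_an ∈ ℤ_p[Z]` with `P_g = T^{ord g}(1+T)^{k_alg}H_alg(Z)`, `P_L = T^{ord Lη}(1+T)^{k_an}H_an(Z)` such that:
**(Kato reading) `pⁿ·Lη ∈ Char(D.X)` ⟹ `m_g ≤ m_L + n ∧ ord g ≤ ord Lη ∧ H_alg ∣ H_an`**; **(Eisenstein reading) `Char(D.X) ⊆ (Lη)` ⟹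
`m_L ≤ m_g ∧ ord Lη ≤ ord g ∧ H_an ∣ H_alg`**; **(main conjecture) `Char(D.X) = (Lη)` ⟺ `m_g = m_L ∧ ord g = ord Lη ∧ H_alg = H_an`**.
CONDITIONAL on `hKim` (named fact in hypothesis position); nothing else assumed. [cite: Kobayashi2003, §4 Even main conjecture, Thm. 4.1 (p. 8)]
[cite: KimBD2008MRL, Thm. 3.11 (p. 93)] [cite: GreenbergVatsal2000, p. 4 (after Thm. (1.2))] [cite: Washington1997, §7.1 (Thm. 7.3), §13.2] -/
theorem exists_normForm_pair_plus_of_kim (hKim : Kim2008.thm311_etaSignedSelmerDual_charIdeal_map_invol)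
    (hη : ∀ σ ∈ galRange (K := ℚ) K₀, ηq σ = 1) (hp5 : 5 ≤ p) (hgood : V.HasGoodReductionAtPrime p)
    (hap : V.frobeniusTrace p = 0) (hκ : κ.IsCyclotomic) (hγ : κ.IsTopGenerator γ) (hγ₀ : γ ∈ galRange (K := ℚ) K₀)
    (D : EtaSignedSelmerDualData V κ K₀ ℚ_[p] ηq γ ε) {g : IwasawaAlgebra p} (hg : D.charIdeal = Ideal.span {g}) (hg0 : g ≠ 0)
    {mg : ℕ} {Pg : Polynomial ℤ_[p]} (hPg : Pg.IsDistinguishedAt (IsLocalRing.maximalIdeal ℤ_[p])) {Ug : IwasawaAlgebra p} (hUg : IsUnit Ug)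
    (hgW : g = C ((p : ℤ_[p]) ^ mg) * (Pg : IwasawaAlgebra p) * Ug)
    (hf : IsNewformOf V f) {ϖ : ℚ} {Lη : IwasawaAlgebra p} (hL : IsQuadraticBranchPlusLFunction f p ϖ Lη) (hL0 : Lη ≠ 0)
    {mL : ℕ} {PL : Polynomial ℤ_[p]} (hPL : PL.IsDistinguishedAt (IsLocalRing.maximalIdeal ℤ_[p])) {UL : IwasawaAlgebra p} (hUL : IsUnit UL)
    (hLW : Lη = C ((p : ℤ_[p]) ^ mL) * (PL : IwasawaAlgebra p) * UL)
    (hr : 2 * r = -1) (hS : S = X * binomialSeries ℤ_[p] r) (hZ : Z = X + invol p X) :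
    ∃ Hg HL : Polynomial ℤ_[p], Hg.IsDistinguishedAt (IsLocalRing.maximalIdeal ℤ_[p]) ∧ HL.IsDistinguishedAt (IsLocalRing.maximalIdeal ℤ_[p]) ∧
      (Pg : IwasawaAlgebra p) = X ^ (PowerSeries.order g).toNat * (1 + X) ^ Hg.natDegree * PowerSeries.subst Z (Hg : IwasawaAlgebra p) ∧
      (PL : IwasawaAlgebra p) = X ^ (PowerSeries.order Lη).toNat * (1 + X) ^ HL.natDegree * PowerSeries.subst Z (HL : IwasawaAlgebra p) ∧
      (∀ n : ℕ, (p : IwasawaAlgebra p) ^ n * Lη ∈ D.charIdeal →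
        mg ≤ mL + n ∧ (PowerSeries.order g).toNat ≤ (PowerSeries.order Lη).toNat ∧ Hg ∣ HL) ∧
      (D.charIdeal ≤ Ideal.span {Lη} → mL ≤ mg ∧ (PowerSeries.order Lη).toNat ≤ (PowerSeries.order g).toNat ∧ HL ∣ Hg) ∧
      (D.charIdeal = Ideal.span {Lη} ↔ mg = mL ∧ (PowerSeries.order g).toNat = (PowerSeries.order Lη).toNat ∧ Hg = HL) := by
  obtain ⟨Hg, hHg, hPHg, -⟩ :=
    weierstrass_eq_X_pow_mul_normPoly_charGenerator_of_kim K₀ hKim hη hp5 hgood hap hκ hγ hγ₀ D hg hg0 hr hZ hPg hUg hgW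
  obtain ⟨HL, hHL, hPHL, -⟩ := exists_normForm_plus_row hp5 V hgood hap hf hr hS hZ hL hL0 hPL hUL hLW
  exact ⟨Hg, HL, hHg, hHL, hPHg, hPHL,
    fun n hn ↦ normForm_of_pow_mul_mem_span hr hS hZ hPg hPL hUg hUL hgW hLW hHg hHL hPHg hPHL hg hn,
    fun hle ↦ normForm_of_span_le_span hr hS hZ hPg hPL hUg hUL hgW hLW hHg hHL hPHg hPHL hg hle,
    span_eq_span_iff_normForm hr hS hZ hPg hPL hUg hUL hgW hLW hHg hHL hPHg hPHL hg⟩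

/-- **(C1⁺_η) ⟹ THE THREE EQUALITIES.** Granted Kim 3.11η, the typed node `QuadraticBranchPlusEtaMainConjectureAt V p` (Kobayashi's even main
conjecture at `η`, verbatim) gives, for every frame datum of §99 with `ε = 1`, `η ≠ 1`, the period ratio matched to the parity of `η` and `γ`
matching the cyclotomic variable: **`m_g = m_L`, `ord g = ord Lη`, and `H_alg = H_an`** for the norm polynomials of ANY Weierstrass data of `g`
and `Lη`. Both the conjecture and Kim 3.11η are in HYPOTHESIS position. [cite: Kobayashi2003, §4 Even main conjecture (p. 8)]
[cite: KimBD2008MRL, Thm. 3.11 (p. 93)] [cite: GreenbergVatsal2000, p. 4 (after Thm. (1.2))] -/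
theorem normForm_eq_of_plusEtaMainConjectureAt_of_kim (hKim : Kim2008.thm311_etaSignedSelmerDual_charIdeal_map_invol)
    (hMC : QuadraticBranchPlusEtaMainConjectureAt V p)
    (hη : ∀ σ ∈ galRange (K := ℚ) K₀, ηq σ = 1) (hη1 : ηq ≠ 1) (hp5 : 5 ≤ p) (hgood : V.HasGoodReductionAtPrime p)
    (hap : V.frobeniusTrace p = 0) (hκ : κ.IsCyclotomic) (hγ : κ.IsTopGenerator γ) (hγ₀ : γ ∈ galRange (K := ℚ) K₀)
    (hγc : IsCyclotomicVariable p γ)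
    (D : EtaSignedSelmerDualData V κ K₀ ℚ_[p] ηq γ 1) {g : IwasawaAlgebra p} (hg : D.charIdeal = Ideal.span {g}) (hg0 : g ≠ 0)
    {mg : ℕ} {Pg : Polynomial ℤ_[p]} (hPg : Pg.IsDistinguishedAt (IsLocalRing.maximalIdeal ℤ_[p])) {Ug : IwasawaAlgebra p} (hUg : IsUnit Ug)
    (hgW : g = C ((p : ℤ_[p]) ^ mg) * (Pg : IwasawaAlgebra p) * Ug)
    (hf : IsNewformOf V f) {ϖ : ℚ}
    (hϖ : if Even (p / 2) then (ϖ : ℝ) * V.realPeriodRat = plusPeriod f else (ϖ : ℝ) * V.imaginaryPeriodRat = minusPeriod f)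
    {Lη : IwasawaAlgebra p} (hL : IsQuadraticBranchPlusLFunction f p ϖ Lη) (hL0 : Lη ≠ 0)
    {mL : ℕ} {PL : Polynomial ℤ_[p]} (hPL : PL.IsDistinguishedAt (IsLocalRing.maximalIdeal ℤ_[p])) {UL : IwasawaAlgebra p} (hUL : IsUnit UL)
    (hLW : Lη = C ((p : ℤ_[p]) ^ mL) * (PL : IwasawaAlgebra p) * UL)
    (hr : 2 * r = -1) (hS : S = X * binomialSeries ℤ_[p] r) (hZ : Z = X + invol p X) :
    ∃ Hg HL : Polynomial ℤ_[p], Hg.IsDistinguishedAt (IsLocalRing.maximalIdeal ℤ_[p]) ∧ HL.IsDistinguishedAt (IsLocalRing.maximalIdeal ℤ_[p]) ∧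
      (Pg : IwasawaAlgebra p) = X ^ (PowerSeries.order g).toNat * (1 + X) ^ Hg.natDegree * PowerSeries.subst Z (Hg : IwasawaAlgebra p) ∧
      (PL : IwasawaAlgebra p) = X ^ (PowerSeries.order Lη).toNat * (1 + X) ^ HL.natDegree * PowerSeries.subst Z (HL : IwasawaAlgebra p) ∧
      mg = mL ∧ (PowerSeries.order g).toNat = (PowerSeries.order Lη).toNat ∧ Hg = HL ∧ Pg = PL := by
  have hp2 : p ≠ 2 := by omega
  obtain ⟨Hg, HL, hHg, hHL, hPHg, hPHL, -, -, hiff⟩ :=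
    exists_normForm_pair_plus_of_kim K₀ hKim hη hp5 hgood hap hκ hγ hγ₀ D hg hg0 hPg hUg hgW hf hL hL0 hPL hUL hLW hr hS hZ
  have hC := (hMC K₀ ηq hη hη1 hp2 hgood hap hf ϖ hϖ Lη hL κ γ hκ hγ hγ₀ hγc D).2.2
  obtain ⟨hm, hrr, hH⟩ := hiff.mp hC
  refine ⟨Hg, HL, hHg, hHL, hPHg, hPHL, hm, hrr, hH, ?_⟩
  apply Polynomial.coe_injective
  rw [hPHg, hPHL, hrr, hH]

/-- **Kobayashi Thm. 4.1 at `η` ⟹ THE KATO READING** (both named facts in hypothesis position): for every frame datum of §99 with `ε = 1`, `η ≠ 1`,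
matched period ratio and cyclotomic variable, and `D.X` finitely generated torsion (Thm. 2.2η, here a hypothesis), there is `n` with
**`m_g ≤ m_L + n`, `ord g ≤ ord Lη`, `H_alg ∣ H_an` in `ℤ_p[Z]`** — and `n = 0` if the `p`-adic tower of `V` is onto. [cite: Kobayashi2003, Thm. 4.1 (p. 8)]
[cite: KimBD2008MRL, Thm. 3.11 (p. 93)] [cite: Washington1997, §7.1 (Thm. 7.3), §13.2] -/
theorem normForm_of_thm41_of_kim (hKim : Kim2008.thm311_etaSignedSelmerDual_charIdeal_map_invol)
    (h41 : Kobayashi2003.thm41_plusEtaCharIdeal_dvd)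
    (hη : ∀ σ ∈ galRange (K := ℚ) K₀, ηq σ = 1) (hη1 : ηq ≠ 1) (hp5 : 5 ≤ p) (hgood : V.HasGoodReductionAtPrime p)
    (hap : V.frobeniusTrace p = 0) (hκ : κ.IsCyclotomic) (hγ : κ.IsTopGenerator γ) (hγ₀ : γ ∈ galRange (K := ℚ) K₀)
    (hγc : IsCyclotomicVariable p γ)
    (D : EtaSignedSelmerDualData V κ K₀ ℚ_[p] ηq γ 1) (hfin : Module.Finite (IwasawaAlgebra p) D.X)
    (htor : Module.IsTorsion (IwasawaAlgebra p) D.X) {g : IwasawaAlgebra p} (hg : D.charIdeal = Ideal.span {g}) (hg0 : g ≠ 0)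
    {mg : ℕ} {Pg : Polynomial ℤ_[p]} (hPg : Pg.IsDistinguishedAt (IsLocalRing.maximalIdeal ℤ_[p])) {Ug : IwasawaAlgebra p} (hUg : IsUnit Ug)
    (hgW : g = C ((p : ℤ_[p]) ^ mg) * (Pg : IwasawaAlgebra p) * Ug)
    (hf : IsNewformOf V f) {ϖ : ℚ}
    (hϖ : if Even (p / 2) then (ϖ : ℝ) * V.realPeriodRat = plusPeriod f else (ϖ : ℝ) * V.imaginaryPeriodRat = minusPeriod f)
    {Lη : IwasawaAlgebra p} (hL : IsQuadraticBranchPlusLFunction f p ϖ Lη) (hL0 : Lη ≠ 0)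
    {mL : ℕ} {PL : Polynomial ℤ_[p]} (hPL : PL.IsDistinguishedAt (IsLocalRing.maximalIdeal ℤ_[p])) {UL : IwasawaAlgebra p} (hUL : IsUnit UL)
    (hLW : Lη = C ((p : ℤ_[p]) ^ mL) * (PL : IwasawaAlgebra p) * UL)
    (hr : 2 * r = -1) (hS : S = X * binomialSeries ℤ_[p] r) (hZ : Z = X + invol p X) :
    ∃ (Hg HL : Polynomial ℤ_[p]) (n : ℕ), Hg.IsDistinguishedAt (IsLocalRing.maximalIdeal ℤ_[p]) ∧
      HL.IsDistinguishedAt (IsLocalRing.maximalIdeal ℤ_[p]) ∧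
      (Pg : IwasawaAlgebra p) = X ^ (PowerSeries.order g).toNat * (1 + X) ^ Hg.natDegree * PowerSeries.subst Z (Hg : IwasawaAlgebra p) ∧
      (PL : IwasawaAlgebra p) = X ^ (PowerSeries.order Lη).toNat * (1 + X) ^ HL.natDegree * PowerSeries.subst Z (HL : IwasawaAlgebra p) ∧
      mg ≤ mL + n ∧ (PowerSeries.order g).toNat ≤ (PowerSeries.order Lη).toNat ∧ Hg ∣ HL ∧
      ((∀ m : ℕ, V.HasSurjectiveModNGaloisRep (p ^ m : ℕ)) → n = 0) := by
  have hp2 : p ≠ 2 := by omega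
  obtain ⟨Hg, HL, hHg, hHL, hPHg, hPHL, hKato, -, -⟩ :=
    exists_normForm_pair_plus_of_kim K₀ hKim hη hp5 hgood hap hκ hγ hγ₀ D hg hg0 hPg hUg hgW hf hL hL0 hPL hUL hLW hr hS hZ
  obtain ⟨⟨n, hn⟩, honto⟩ := h41 p K₀ ηq hη hη1 V hp2 hgood hap hf ϖ hϖ Lη hL κ γ hκ hγ hγ₀ hγc D.toLiterature hfin htor
  rw [EtaSignedSelmerDualData.charIdeal_toLiterature] at hn honto
  by_cases hsurj : ∀ m : ℕ, V.HasSurjectiveModNGaloisRep (p ^ m : ℕ)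
  · have h0 : (p : IwasawaAlgebra p) ^ 0 * Lη ∈ D.charIdeal := by rw [pow_zero, one_mul]; exact honto hsurj
    obtain ⟨hm, hrr, hH⟩ := hKato 0 h0
    exact ⟨Hg, HL, 0, hHg, hHL, hPHg, hPHL, hm, hrr, hH, fun _ ↦ rfl⟩
  · obtain ⟨hm, hrr, hH⟩ := hKato n hn
    exact ⟨Hg, HL, n, hHg, hHL, hPHg, hPHL, hm, hrr, hH, fun h ↦ absurd h hsurj⟩

/-- **(E⁺_η) ⟹ THE EISENSTEIN READING** (typed conjecture and Kim 3.11η in hypothesis position): for every frame datum of §99 with `ε = 1`,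
`η ≠ 1`, matched period ratio and cyclotomic variable: **`m_L ≤ m_g`, `ord Lη ≤ ord g`, `H_an ∣ H_alg` in `ℤ_p[Z]`**.
[cite: Kobayashi2003, §4 Even main conjecture (p. 8)] [cite: KimBD2008MRL, Thm. 3.11 (p. 93)] [cite: Washington1997, §7.1 (Thm. 7.3), §13.2] -/
theorem normForm_of_plusEtaLowerInclusionAt_of_kim (hKim : Kim2008.thm311_etaSignedSelmerDual_charIdeal_map_invol)
    (hE : QuadraticBranchPlusEtaLowerInclusionAt V p)
    (hη : ∀ σ ∈ galRange (K := ℚ) K₀, ηq σ = 1) (hη1 : ηq ≠ 1) (hp5 : 5 ≤ p) (hgood : V.HasGoodReductionAtPrime p)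
    (hap : V.frobeniusTrace p = 0) (hκ : κ.IsCyclotomic) (hγ : κ.IsTopGenerator γ) (hγ₀ : γ ∈ galRange (K := ℚ) K₀)
    (hγc : IsCyclotomicVariable p γ)
    (D : EtaSignedSelmerDualData V κ K₀ ℚ_[p] ηq γ 1) {g : IwasawaAlgebra p} (hg : D.charIdeal = Ideal.span {g}) (hg0 : g ≠ 0)
    {mg : ℕ} {Pg : Polynomial ℤ_[p]} (hPg : Pg.IsDistinguishedAt (IsLocalRing.maximalIdeal ℤ_[p])) {Ug : IwasawaAlgebra p} (hUg : IsUnit Ug)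
    (hgW : g = C ((p : ℤ_[p]) ^ mg) * (Pg : IwasawaAlgebra p) * Ug)
    (hf : IsNewformOf V f) {ϖ : ℚ}
    (hϖ : if Even (p / 2) then (ϖ : ℝ) * V.realPeriodRat = plusPeriod f else (ϖ : ℝ) * V.imaginaryPeriodRat = minusPeriod f)
    {Lη : IwasawaAlgebra p} (hL : IsQuadraticBranchPlusLFunction f p ϖ Lη) (hL0 : Lη ≠ 0)
    {mL : ℕ} {PL : Polynomial ℤ_[p]} (hPL : PL.IsDistinguishedAt (IsLocalRing.maximalIdeal ℤ_[p])) {UL : IwasawaAlgebra p} (hUL : IsUnit UL)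
    (hLW : Lη = C ((p : ℤ_[p]) ^ mL) * (PL : IwasawaAlgebra p) * UL)
    (hr : 2 * r = -1) (hS : S = X * binomialSeries ℤ_[p] r) (hZ : Z = X + invol p X) :
    ∃ Hg HL : Polynomial ℤ_[p], Hg.IsDistinguishedAt (IsLocalRing.maximalIdeal ℤ_[p]) ∧ HL.IsDistinguishedAt (IsLocalRing.maximalIdeal ℤ_[p]) ∧
      (Pg : IwasawaAlgebra p) = X ^ (PowerSeries.order g).toNat * (1 + X) ^ Hg.natDegree * PowerSeries.subst Z (Hg : IwasawaAlgebra p) ∧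
      (PL : IwasawaAlgebra p) = X ^ (PowerSeries.order Lη).toNat * (1 + X) ^ HL.natDegree * PowerSeries.subst Z (HL : IwasawaAlgebra p) ∧
      mL ≤ mg ∧ (PowerSeries.order Lη).toNat ≤ (PowerSeries.order g).toNat ∧ HL ∣ Hg := by
  have hp2 : p ≠ 2 := by omega
  obtain ⟨Hg, HL, hHg, hHL, hPHg, hPHL, -, hEis, -⟩ :=
    exists_normForm_pair_plus_of_kim K₀ hKim hη hp5 hgood hap hκ hγ hγ₀ D hg hg0 hPg hUg hgW hf hL hL0 hPL hUL hLW hr hS hZ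
  obtain ⟨hm, hrr, hH⟩ := hEis (hE K₀ ηq hη hη1 hp2 hgood hap hf ϖ hϖ Lη hL κ γ hκ hγ hγ₀ hγc D)
  exact ⟨Hg, HL, hHg, hHL, hPHg, hPHL, hm, hrr, hH⟩

end Crux

end Summit.BirchSwinnertonDyer.BirchSwinnertonDyer.Theorems.EtaThetaFunctionalEquation

end
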